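import Summits.HodgeConjecture.HodgeCM.PerL34.GaloisB3Field_1

/-! PORT of `HodgeCM/PerL34/GaloisB3Field.lean` (HodgeCMPerL run 82) — part 2: continuation of `Summits.HodgeConjecture.HodgeCM.PerL34.GaloisB3Field_1` (split at a top-level declaration boundary by port_pkg.py; scope re-opened below; declarations unchanged). -/

-- port_pkg: scope re-opened for this part (file-level context, then the namespace/section stack open at the cut)
set_option autoImplicit false
namespace HodgeCM
namespace PerL34
namespace GaloisB3
open HodgeCM.Prior.ReflexLemma.RfwfReflex IntermediateField
section CM
open NumberField
variable {L : Type*} [Field L] [NumberField L] [IsCMField L] (K : IntermediateField ℚ L)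
/-- `c` moves every embedding into `L` of a totally imaginary number field `K` (embedded form). -/
theorem conjL_smul_ne' {K : Type*} [Field K] [NumberField K] [IsTotallyComplex K] (φ : K →ₐ[ℚ] L) :
    (conjL : L ≃ₐ[ℚ] L) • φ ≠ φ := by
  intro h
  obtain ⟨ψ⟩ : Nonempty (L →+* ℂ) := inferInstance
  have hreal : ComplexEmbedding.IsReal (ψ.comp (φ : K →+* L)) := by
    rw [ComplexEmbedding.isReal_iff]
    ext k
    have hk : IsCMField.complexConj L (φ k) = φ k := by
      have := AlgHom.congr_fun h k
      rwa [emb_smul_apply' K] at this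
    have hmem : φ k ∈ maximalRealSubfield L := (IsCMField.complexConj_eq_self_iff L (φ k)).mp hk
    have hstar := (mem_maximalRealSubfield_iff (φ k)).mp hmem ψ
    rw [ComplexEmbedding.conjugate_coe_eq, RingHom.coe_comp, Function.comp_apply]
    rw [RCLike.star_def] at hstar
    exact hstar
  exact IsTotallyComplex.complexEmbedding_not_isReal _ hreal

omit [IsCMField L] in
/-- A normal closure of a number field `K` is Galois over `ℚ` (embedded form). -/
theorem isGalois_of_isNormalClosure' (K : Type*) [Field K] [NumberField K] [IsNormalClosure ℚ K L] :
    IsGalois ℚ L := by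
  haveI : Normal ℚ L := IsNormalClosure.normal (F := ℚ) (K := K) (L := L)
  exact ⟨⟩

/-- **PerL Lemma 2.1(b) "`H' = H`", embedded final form (everything about `c` derived).**  `K` a totally
imaginary (e.g. CM) number field with `[K:ℚ] = 6`; `L` a CM field which is a normal closure of `K`,
`[L:ℚ] ∈ {24,48}`; `ψ₀ : K ↪ L`; `Φ ∋ ψ₀` a CM type read in `L`.  Then the right stabiliser of
`\widetilde Φ = {g : g ∘ ψ₀ ∈ Φ}` is `Gal(L/ψ₀K)`. -/
theorem rightStab_eq_gal_emb {K : Type*} [Field K] [NumberField K] [IsNormalClosure ℚ K L]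
    [IsTotallyComplex K]
    (hK : Module.finrank ℚ K = 6) (hL : Module.finrank ℚ L = 24 ∨ Module.finrank ℚ L = 48)
    (Φ : Finset (K →ₐ[ℚ] L)) (hΦ : ∀ φ, φ ∈ Φ ↔ (conjL : L ≃ₐ[ℚ] L) • φ ∉ Φ)
    (ψ₀ : K →ₐ[ℚ] L) (h0 : ψ₀ ∈ Φ) :
    rightStab {g : L ≃ₐ[ℚ] L | g • ψ₀ ∈ Φ} = ψ₀.fieldRange.fixingSubgroup := by
  haveI := isGalois_of_isNormalClosure' (L := L) K
  exact rightStab_eq_fixingSubgroup_emb hK hL conjL conjL_central conjL_mul_conjL conjL_smul_ne' Φ hΦ ψ₀ h0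

/-- **No quadratic subfield**, embedded final form. -/
theorem no_quadratic_subfield_emb' {K : Type*} [Field K] [NumberField K] [IsNormalClosure ℚ K L]
    [IsTotallyComplex K]
    (hK : Module.finrank ℚ K = 6) (hL : Module.finrank ℚ L = 24 ∨ Module.finrank ℚ L = 48)
    (ψ₀ : K →ₐ[ℚ] L) (E : IntermediateField ℚ L) (hEK : E ≤ ψ₀.fieldRange)
    (hE : Module.finrank ℚ E = 2) : False := by
  haveI := isGalois_of_isNormalClosure' (L := L) K
  exact no_quadratic_subfield_emb hK hL conjL conjL_central conjL_mul_conjL conjL_smul_ne' ψ₀ E hEK hE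

end CM

end GaloisB3
end PerL34
end HodgeCM
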